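import Summits.BirchSwinnertonDyer.BirchSwinnertonDyer.Theorems.PrintCFramBottomClassIndexLawFiveLeCohenCutIntegrality
import Literature.NumberTheory.Congruences.GeneralizedBernoulliCarlitzIntegrality
import HarnessLib

/-!
# Crux `PrintCFram.BottomClassIndexLawFiveLe` (stmt-BirchSwinnertonDyer-20372), line `eisenstein-resource-bdp-line` (registry v24):
# THE CUT COHEN NUMBERS ARE INTEGRAL AWAY FROM `2` — Carlitz's theorem at EVERY odd prime `ℓ` (conductor primes and `ℓ ∣ n₀` included)
# (cell `bsd-print-cfram`, width seat `bsd-line-cfram-p1-w7` g6; THEOREMS ONLY, `--supports` 20372; BSD is not proved by any of this)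

HONEST FRAMING. Nothing here is a statement about BSD or about any curve; no registered stub is closed. This is the INTEGRALITY INPUT
of the `q`-expansion-principle step of the cusp glue of `stub_cuspCutForm` (conjunct (iii) `G = 0 ⟹ ι C = 0`): the typed named fact
`Literature.NumberTheory.ModularForms.Katz1973_qExpansionPrinciple_allCusps` (NF-Q) wants EVERY coefficient of the vehicle at `∞` in
`d · ℤ̄[1/N]` (`N` the level: primes `2, 3`, those of `m`, `r`), whereas `G = 0` and the `p`-integrality of `…CohenCutIntegrality`
(w4 g12) only give `p ∣` the cut Cohen numbers `H(k, m n₀ f²) = L(1−k, χ_{D'})·T`, `D' = e*·(−n₀)`. Here: for a class datum with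
`m ≠ 1` (the class character `χ` non-trivial) and EVERY ODD PRIME `ℓ` — the primes of the conductor `m n₀` and `ℓ ∣ n₀` included —
`‖H(k, m n₀ f²)‖_ℓ ≤ 1`. This is Carlitz's theorem [Carlitz1959] «`k⁻¹B_{k,ψ}` is an algebraic integer when the conductor of `ψ` has
two distinct prime factors» (`|D'| = m·n₀`, `gcd(m, n₀) = 1`), in the `ℓ`-adic form of `Literature.NumberTheory.Congruences.
CarlitzIntegrality` (Lang's measures at any level): the auxiliary `c ≡ 1 (mod ℓ)` with `χ_{D'}(c) = −1` comes from the Chinese remainder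
theorem between `m` and `n₀` (`χ(c₀) = −1` on the `m`-side when `ℓ ∤ m`; `J(−1 | n₀) = −1` on the `n₀`-side when `ℓ ∣ m`). For `m = 1`
(untwisted datum) odd denominators DO occur (`H(3, 7) = −16/7`) — see part 2 `…CohenCutCarlitzLevelOne`.
§1 `χ_{D'}` is `m n₀`-periodic and completely multiplicative (`K`-free); §2 `B_{k,χ_D}` as a `bernoulliDist` sum in `ℚ_ℓ`; §3 the
auxiliary `c` and **`norm_lValueDisc_cut_le_one_of_odd_prime`**; §4 **`norm_ratCast_cohenH_cut_le_one_of_odd_prime`**,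
**`norm_ratCast_cohenH_le_one_of_cut_of_odd_prime`** (`‖H(k, a)‖_ℓ ≤ 1` on the `m`-cut, every odd `ℓ`); §5 the rational reading
**`dvd_den_cohenH_cut_imp_eq_two`** (den `H(k,a)` is a power of `2`); §6 THE SOCKET **`exists_eq_prime_mul_cohenH_of_cut_of_norm_lt_one`**
(`‖H(k,a)‖_p < 1 ⟹ H(k,a) = p·y`, `2^j·y ∈ ℤ`) and `exists_isIntegral_pow_mul_of_two_pow_mul` (NF-Q currency for even `N`).
beyond-print theorem: NO. References: [Carlitz1959]; [BillereyMenares2018] proof of Lemma 3 (the printed `d`); [LangCyclotomic1990]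
Ch. 2 §2 Thms 2.1, 2.4; [Cohen1975] §2; [MontgomeryVaughan2007] Thm. 9.13; crux notes `Lines/eisenstein-resource-bdp-line-w5g5-cusp-seed.md` §14–§15.
-/

set_option autoImplicit false
-- summit-side namespace `Summit.BirchSwinnertonDyer.BirchSwinnertonDyer.…` (single-conjunct summit, D-0017 layout)
set_option linter.dupNamespace false

noncomputable section

open scoped Classical NumberTheorySymbols
open NumberField DirichletCharacter
open Literature.NumberTheory.LFunctions Literature.NumberTheory.ModularForms.CohenEisenstein Literature.NumberTheory.EllipticCurves
  Literature.NumberTheory.Congruences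

namespace Summit.BirchSwinnertonDyer.BirchSwinnertonDyer.Theorems.PrintCFram.CohenCut

open Summit.BirchSwinnertonDyer.BirchSwinnertonDyer.Theorems.PrintCFram

variable {p : ℕ} [hp : Fact p.Prime]

/-! ## §1 `χ_{D'}` is periodic modulo `m n₀` and completely multiplicative (`K`-free) -/

section Values

variable {m : ℕ} [NeZero m] {χ : DirichletCharacter ℚ_[p] m} {s : ℤ} {n₀ : ℕ}

/-- The values `χ_{D'}(c) = χ(c) · J(c | n₀)`, `D' = e*·(−n₀)`, `e* = s·m`, read in `ℚ_p`. [cite: MontgomeryVaughan2007, Thm. 9.13] -/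
theorem intCast_chiDisc_cut_eq (hχ : χ.IsPrimitive) (hχq : χ.IsQuadratic) (hs : χ (-1) = (s : ℚ_[p])) (hs1 : s = 1 ∨ s = -1)
    (h4 : n₀ % 4 = 3) (c : ℕ) :
    (chiDisc (s * m * -(n₀ : ℤ)) c : ℚ_[p]) = χ (c : ZMod m) * (J((c : ℤ) | n₀) : ℚ_[p]) := by
  obtain ⟨he, hs0⟩ := sign_mul_emod_four hχ hχq hs hs1
  rw [apply_natCast_eq_chiDisc hχ hχq hs hs1 c, ← Int.cast_mul, chiDisc_mul_jacobiSym he hs0 h4 c]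

/-- **`χ_{D'}` is `m n₀`-periodic**: `χ_{D'}(c + m n₀) = χ_{D'}(c)`. [cite: MontgomeryVaughan2007, Thm. 9.13] -/
theorem chiDisc_cut_add_mul (hχ : χ.IsPrimitive) (hχq : χ.IsQuadratic) (hs : χ (-1) = (s : ℚ_[p])) (hs1 : s = 1 ∨ s = -1)
    (h4 : n₀ % 4 = 3) (c : ℕ) :
    chiDisc (s * m * -(n₀ : ℤ)) (c + m * n₀) = chiDisc (s * m * -(n₀ : ℤ)) c := by
  apply Int.cast_injective (α := ℚ_[p])
  rw [intCast_chiDisc_cut_eq hχ hχq hs hs1 h4, intCast_chiDisc_cut_eq hχ hχq hs hs1 h4]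
  congr 1
  · push_cast
    rw [ZMod.natCast_self, zero_mul, add_zero]
  · rw [jacobiSym.mod_left ((c + m * n₀ : ℕ) : ℤ), jacobiSym.mod_left (c : ℤ)]
    congr 1
    push_cast
    rw [mul_comm, Int.add_mul_emod_self_left]

/-- **`χ_{D'}` is completely multiplicative**: `χ_{D'}(xy) = χ_{D'}(x) χ_{D'}(y)`. [cite: MontgomeryVaughan2007, Thm. 9.13] -/
theorem chiDisc_cut_mul (hχ : χ.IsPrimitive) (hχq : χ.IsQuadratic) (hs : χ (-1) = (s : ℚ_[p])) (hs1 : s = 1 ∨ s = -1)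
    (h4 : n₀ % 4 = 3) (x y : ℕ) :
    chiDisc (s * m * -(n₀ : ℤ)) (x * y) = chiDisc (s * m * -(n₀ : ℤ)) x * chiDisc (s * m * -(n₀ : ℤ)) y := by
  apply Int.cast_injective (α := ℚ_[p])
  rw [Int.cast_mul, intCast_chiDisc_cut_eq hχ hχq hs hs1 h4, intCast_chiDisc_cut_eq hχ hχq hs hs1 h4,
    intCast_chiDisc_cut_eq hχ hχq hs hs1 h4]
  push_cast
  rw [map_mul, jacobiSym.mul_left, Int.cast_mul]
  ring

end Values

/-! ## §2 `B_{k,χ_D}` as a sum against the tree's Bernoulli distribution, read in `ℚ_ℓ` -/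

/-- **`B_{k,χ_D} = ∑_{b mod |D|} χ_D(b) · |D|^{k−1} B_k(b/|D|)`** (`k ≥ 1`), read in `ℚ_ℓ` with the tree's `bernoulliDist`
(`= |D|^{k−1} B_k(b.val/|D|)`) and the integer Kronecker symbol `chiDisc`. [cite: Washington1997, Prop. 4.1] -/
theorem ratCast_bernoulliDisc_eq_sum {ℓ : ℕ} [Fact ℓ.Prime] {k : ℕ} (hk : 1 ≤ k) (D : ℤ) [NeZero D.natAbs] :
    ((bernoulliDisc k D : ℚ) : ℚ_[ℓ]) =
      ∑ b : ZMod D.natAbs, ((chiDisc D b.val : ℤ) : ℚ_[ℓ]) * ((bernoulliDist k D.natAbs b : ℚ) : ℚ_[ℓ]) := by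
  -- summation over `ZMod |D|` through `val` is summation over `range |D|`
  have hsum : ∀ (n : ℕ) [NeZero n] (g : ℕ → ℚ_[ℓ]), ∑ j : ZMod n, g j.val = ∑ c ∈ Finset.range n, g c := by
    intro n _ g
    cases n with
    | zero => exact absurd rfl (NeZero.ne 0)
    | succ n => exact Fin.sum_univ_eq_sum_range (fun c => g c) (n + 1)
  rw [bernoulliDisc, Rat.cast_sum, ← hsum D.natAbs (fun c => (((chiDisc D c : ℚ) * genBernoulliCoeff k D.natAbs c : ℚ) : ℚ_[ℓ]))]
  refine Finset.sum_congr rfl fun b _ => ?_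
  rw [Rat.cast_mul, Rat.cast_intCast, genBernoulliCoeff_of_one_le hk, bernoulliDist]

/-! ## §3 The auxiliary unit and `ℓ`-integrality of `L(1 − k, χ_{D'})` for every odd prime `ℓ` (class data with `m ≠ 1`) -/

section OddPrime

variable {m : ℕ} [NeZero m] {χ : DirichletCharacter ℚ_[p] m} {s : ℤ} {k n₀ : ℕ}

/-- A primitive quadratic character modulo `m ≠ 1` takes the value `−1` at some natural number prime to `m`.
[cite: MontgomeryVaughan2007, Thm. 9.13] -/
theorem exists_apply_eq_neg_one (hm1 : m ≠ 1) (hχ : χ.IsPrimitive) (hχq : χ.IsQuadratic) :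
    ∃ c₀ : ℕ, c₀.Coprime m ∧ χ (c₀ : ZMod m) = -1 := by
  have hne : χ ≠ 1 := by
    intro h
    have hc : χ.conductor = m := hχ
    rw [h, conductor_one] at hc
    exact hm1 hc.symm
  obtain ⟨u, hu⟩ := MulChar.ne_one_iff.mp hne
  refine ⟨(u : ZMod m).val, (ZMod.isUnit_iff_coprime _ _).mp (by rw [ZMod.natCast_zmod_val]; exact u.isUnit), ?_⟩
  rw [ZMod.natCast_zmod_val]
  rcases hχq (u : ZMod m) with h0 | h1 | h2
  · exact absurd h0 (by rw [← MulChar.coe_toUnitHom]; exact Units.ne_zero _)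
  · exact absurd h1 hu
  · exact h2

omit [NeZero m] in
/-- `J(n₀ − 1 | n₀) = −1` for `n₀ ≡ 3 (mod 4)` (`J(−1 | n₀) = χ₄(n₀)`). [cite: MontgomeryVaughan2007, Thm. 9.13] -/
theorem jacobiSym_pred_eq_neg_one (h4 : n₀ % 4 = 3) : J(((n₀ - 1 : ℕ) : ℤ) | n₀) = -1 := by
  have h1 : 1 ≤ n₀ := by omega
  have hodd : Odd n₀ := Nat.odd_iff.mpr (by omega)
  rw [jacobiSym.mod_left, show (((n₀ - 1 : ℕ) : ℤ)) % (n₀ : ℤ) = (-1 : ℤ) % (n₀ : ℤ) by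
      rw [Nat.cast_sub h1, Nat.cast_one, show (n₀ : ℤ) - 1 = -1 + (n₀ : ℤ) * 1 by ring, Int.add_mul_emod_self_left],
    ← jacobiSym.mod_left, jacobiSym.at_neg_one hodd, ZMod.χ₄_nat_three_mod_four h4]

/-- **The auxiliary unit for Carlitz's argument.** For a class datum with `m ≠ 1` (`χ` primitive quadratic mod `m`,
`χ(−1) = s`), `n₀ ≡ 3 (mod 4)` prime to `m`, and ANY odd prime `ℓ`: there is `c ∈ ℕ` prime to `m n₀ ℓ` with `c ≡ 1 (mod ℓ)` and
`χ_{D'}(c) = −1`, `D' = e*·(−n₀)`. Construction (Chinese remainder): if `ℓ ∤ m`, `c ≡ c₀ (mod m)` with `χ(c₀) = −1` and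
`c ≡ 1 (mod n₀ℓ)`; if `ℓ ∣ m`, `c ≡ 1 (mod m)` and `c ≡ −1 (mod n₀)` (`J(−1 | n₀) = −1`).
[cite: BillereyMenares2018, proof of Lemma 3 (Carlitz's theorem, arXiv p. 5)] -/
theorem exists_coprime_chiDisc_cut_eq_neg_one {ℓ : ℕ} [hℓ : Fact ℓ.Prime] (hm1 : m ≠ 1) (hχ : χ.IsPrimitive)
    (hχq : χ.IsQuadratic) (hs : χ (-1) = (s : ℚ_[p])) (hs1 : s = 1 ∨ s = -1) (h4 : n₀ % 4 = 3) (hcop : m.Coprime n₀) :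
    ∃ c : ℕ, c.Coprime (m * n₀ * ℓ) ∧ (c : ZMod ℓ) = 1 ∧ chiDisc (s * m * -(n₀ : ℤ)) c = -1 := by
  have hn0 : n₀ ≠ 0 := by omega
  have hval := intCast_chiDisc_cut_eq hχ hχq hs hs1 h4
  by_cases hℓm : ℓ ∣ m
  · -- `ℓ ∣ m`: `c ≡ 1 (mod m)`, `c ≡ −1 (mod n₀)`
    obtain ⟨c, hc1, hc2⟩ := Nat.chineseRemainder hcop 1 (n₀ - 1)
    have hcm : c.Coprime m := by rw [Nat.Coprime, hc1.gcd_eq]; exact Nat.coprime_one_left m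
    have hcn : c.Coprime n₀ := by
      rw [Nat.Coprime, hc2.gcd_eq]
      have h := (Nat.coprime_self_add_left (m := n₀ - 1) (n := 1)).mpr (Nat.coprime_one_left _)
      rw [Nat.sub_add_cancel (show 1 ≤ n₀ by omega)] at h
      exact Nat.coprime_comm.mp h
    refine ⟨c, (Nat.Coprime.mul_right hcm hcn).mul_right (hcm.coprime_dvd_right hℓm), ?_, ?_⟩
    · have := (ZMod.natCast_eq_natCast_iff _ _ _).mpr (hc1.of_dvd hℓm)
      rw [this, Nat.cast_one]
    · apply Int.cast_injective (α := ℚ_[p])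
      have hcm1 : (c : ZMod m) = 1 := by
        have := (ZMod.natCast_eq_natCast_iff _ _ _).mpr hc1
        rw [this, Nat.cast_one]
      have hJ : J((c : ℤ) | n₀) = -1 := by
        rw [jacobiSym.mod_left, show (c : ℤ) % (n₀ : ℤ) = ((n₀ - 1 : ℕ) : ℤ) % (n₀ : ℤ) by exact_mod_cast hc2,
          ← jacobiSym.mod_left, jacobiSym_pred_eq_neg_one h4]
      rw [hval, hcm1, map_one, one_mul, hJ]
  · -- `ℓ ∤ m`: `c ≡ c₀ (mod m)` with `χ(c₀) = −1`, `c ≡ 1 (mod n₀ ℓ)`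
    obtain ⟨c₀, hc₀, hχc₀⟩ := exists_apply_eq_neg_one hm1 hχ hχq
    have hmℓ : m.Coprime ℓ := (Nat.Coprime.symm ((hℓ.out.coprime_iff_not_dvd).mpr hℓm))
    have hco : m.Coprime (n₀ * ℓ) := Nat.Coprime.mul_right hcop hmℓ
    obtain ⟨c, hc1, hc2⟩ := Nat.chineseRemainder hco c₀ 1
    have hcm : (c : ZMod m) = (c₀ : ZMod m) := (ZMod.natCast_eq_natCast_iff _ _ _).mpr hc1
    have hcmc : c.Coprime m := by rw [Nat.Coprime, hc1.gcd_eq]; exact hc₀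
    have hcn : c.Coprime (n₀ * ℓ) := by rw [Nat.Coprime, hc2.gcd_eq]; exact Nat.coprime_one_left _
    refine ⟨c, by rw [mul_assoc]; exact Nat.Coprime.mul_right hcmc hcn, ?_, ?_⟩
    · have := (ZMod.natCast_eq_natCast_iff _ _ _).mpr (hc2.of_mul_left n₀)
      rw [this, Nat.cast_one]
    · apply Int.cast_injective (α := ℚ_[p])
      have hJ : J((c : ℤ) | n₀) = 1 := by
        have h1 : c ≡ 1 [MOD n₀] := hc2.of_mul_right ℓ
        rw [jacobiSym.mod_left, show (c : ℤ) % (n₀ : ℤ) = ((1 : ℕ) : ℤ) % (n₀ : ℤ) by exact_mod_cast h1,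
          ← jacobiSym.mod_left, Nat.cast_one, jacobiSym.one_left]
      rw [hval, hcm, hχc₀, hJ]
      push_cast
      ring

/-- **CARLITZ FOR THE CUT: `‖L(1 − k, χ_{D'})‖_ℓ ≤ 1` for every ODD prime `ℓ`** (`D' = χ(−1)·m·(−n₀)`), for a class character `χ`
primitive quadratic modulo `m ≠ 1`, `n₀ ≡ 3 (mod 4)` squarefree and prime to `m`, and any `k ≥ 1` — the conductor `m n₀` has two
distinct prime factors, so `k⁻¹B_{k,χ_{D'}}` is `ℓ`-integral at every odd `ℓ`, the primes dividing `m n₀` included (Lang's measure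
`χ_{D'}E_{k,c}` at level `m n₀`, ANY `ℓ`, with the auxiliary unit of `exists_coprime_chiDisc_cut_eq_neg_one`).
[cite: Carlitz1959, Theorem (integrality of k⁻¹B_{k,χ} for conductor with two distinct prime factors)] [cite: BillereyMenares2018, proof of Lemma 3 (arXiv p. 5)] -/
theorem norm_lValueDisc_cut_le_one_of_odd_prime {ℓ : ℕ} [hℓ : Fact ℓ.Prime] (hℓ2 : ℓ ≠ 2) (hm1 : m ≠ 1)
    (hχ : χ.IsPrimitive) (hχq : χ.IsQuadratic) (hs : χ (-1) = (s : ℚ_[p])) (hs1 : s = 1 ∨ s = -1) (hk : 1 ≤ k)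
    (hsq : Squarefree n₀) (h4 : n₀ % 4 = 3) (hcop : m.Coprime n₀) :
    ‖((lValueDisc k (s * m * -(n₀ : ℤ)) : ℚ) : ℚ_[ℓ])‖ ≤ 1 := by
  have hN : (s * m * -(n₀ : ℤ)).natAbs = m * n₀ := by
    rw [Int.natAbs_mul, Int.natAbs_neg, Int.natAbs_natCast, show (s * m : ℤ).natAbs = m by rcases hs1 with rfl | rfl <;> simp]
  haveI : NeZero (s * m * -(n₀ : ℤ)).natAbs := ⟨by rw [hN]; exact mul_ne_zero (NeZero.ne m) hsq.ne_zero⟩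
  obtain ⟨c, hc, hc1, hcval⟩ := exists_coprime_chiDisc_cut_eq_neg_one (ℓ := ℓ) hm1 hχ hχq hs hs1 h4 hcop
  -- the integer values of `χ_{D'}` cast into `ℤ_ℓ`
  set θ : ℕ → ℤ_[ℓ] := fun b ↦ ((chiDisc (s * m * -(n₀ : ℤ)) b : ℤ) : ℤ_[ℓ]) with hθ_def
  have hθ : ∀ b, θ (b + (s * m * -(n₀ : ℤ)).natAbs) = θ b := fun b ↦ by
    simp only [hθ_def]
    rw [hN, chiDisc_cut_add_mul hχ hχq hs hs1 h4]
  have hθc : ∀ x, θ (c * x) = θ c * θ x := fun x ↦ by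
    simp only [hθ_def]
    rw [chiDisc_cut_mul hχ hχq hs hs1 h4, Int.cast_mul]
  have hθm : θ c = -1 := by
    simp only [hθ_def]
    rw [hcval, Int.cast_neg, Int.cast_one]
  have hc' : c.Coprime ((s * m * -(n₀ : ℤ)).natAbs * ℓ) := by rw [hN]; exact hc
  have hint := CarlitzIntegrality.norm_sum_mul_bernoulliDist_div_le_one_of_apply_eq_neg_one
    (N := (s * m * -(n₀ : ℤ)).natAbs) hℓ2 hc' hθ hθc hk hc1 hθm
  have hsum : ∑ b : ZMod (s * m * -(n₀ : ℤ)).natAbs, ((θ b.val : ℤ_[ℓ]) : ℚ_[ℓ]) *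
      ((bernoulliDist k (s * m * -(n₀ : ℤ)).natAbs b : ℚ) : ℚ_[ℓ]) =
      ((bernoulliDisc k (s * m * -(n₀ : ℤ)) : ℚ) : ℚ_[ℓ]) := by
    rw [ratCast_bernoulliDisc_eq_sum hk]
    refine Finset.sum_congr rfl fun b _ ↦ ?_
    simp only [hθ_def, PadicInt.coe_intCast]
  rw [hsum] at hint
  rw [lValueDisc, Rat.cast_div, Rat.cast_neg, Rat.cast_natCast, neg_div, norm_neg, div_eq_inv_mul]
  exact hint

end OddPrime

/-! ## §4 `H(k, a)` is `ℓ`-integral at every odd prime `ℓ`, at every index of the `m`-cut (`m ≠ 1`) -/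

section CutCohen

variable {m : ℕ} [NeZero m] {χ : DirichletCharacter ℚ_[p] m} {k : ℕ}

/-- **`‖H(k, m n₀ f²)‖_ℓ ≤ 1` for every ODD prime `ℓ`** (class character `χ` primitive quadratic mod `m ≠ 1` with the parity
clause `χ(−1)(−1)^k = −1`, `k ≥ 1`; `n₀ ≡ 3 (mod 4)` squarefree, `f ≥ 1`, the cut's Jacobi clauses at the odd primes of `m`):
`H = L(1−k, χ_{D'}) · T` with `T ∈ ℤ` and `L(1−k, χ_{D'})` `ℓ`-integral (§3). With w4 g12's `norm_ratCast_cohenH_cut_le_one`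
(the crux prime `ℓ = p`) this covers EVERY odd prime. [cite: Cohen1975, §2 (definition of H(r, N))]
[cite: Carlitz1959, Theorem (integrality of k⁻¹B_{k,χ} for conductor with two distinct prime factors)] -/
theorem norm_ratCast_cohenH_cut_le_one_of_odd_prime {ℓ : ℕ} [Fact ℓ.Prime] (hℓ2 : ℓ ≠ 2) (hm1 : m ≠ 1)
    (hχ : χ.IsPrimitive) (hχq : χ.IsQuadratic) (hk : 1 ≤ k) (hpar : χ (-1) * (-1) ^ k = -1) {n₀ f : ℕ}
    (hsq : Squarefree n₀) (h4 : n₀ % 4 = 3) (hf : 0 < f)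
    (hJ : ∀ q : ℕ, q.Prime → q ∣ m → q ≠ 2 → jacobiSym (-((n₀ * f ^ 2 : ℕ) : ℤ)) q = 1) :
    ‖((cohenH k (m * (n₀ * f ^ 2)) : ℚ) : ℚ_[ℓ])‖ ≤ 1 := by
  obtain ⟨s, hs1', hs⟩ := PrimitiveQuadratic.exists_sign_eq_of_charZero χ
  have hs1 : s = 1 ∨ s = -1 := by rcases hs1' with ⟨h, -⟩ | ⟨h, -⟩ <;> simp [h]
  rw [cohenH_cut_eq hχ hχq hs hs1 hpar hsq h4 hf hJ, Rat.cast_mul, Rat.cast_intCast, norm_mul]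
  exact mul_le_one₀ (norm_lValueDisc_cut_le_one_of_odd_prime hℓ2 hm1 hχ hχq hs hs1 hk hsq h4 (coprime_of_cut h4 hJ))
    (norm_nonneg _) (Padic.norm_int_le_one _)

/-- **`‖H(k, a)‖_ℓ ≤ 1` at every index `a` of the `m`-cut, every odd prime `ℓ`** (`m ∣ a`, `a/m ≡ 3 (mod 4)`, the Jacobi clauses
`J(−(a/m) | q) = 1` at the odd primes `q ∣ m`; class data as above with `m ≠ 1`). [cite: Cohen1975, §2 (definition of H(r, N))]
[cite: Carlitz1959, Theorem (integrality of k⁻¹B_{k,χ} for conductor with two distinct prime factors)] -/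
theorem norm_ratCast_cohenH_le_one_of_cut_of_odd_prime {ℓ : ℕ} [Fact ℓ.Prime] (hℓ2 : ℓ ≠ 2) (hm1 : m ≠ 1)
    (hχ : χ.IsPrimitive) (hχq : χ.IsQuadratic) (hk : 1 ≤ k) (hpar : χ (-1) * (-1) ^ k = -1) {a : ℕ} (hma : m ∣ a)
    (ha4 : a / m % 4 = 3) (hJ : ∀ q : ℕ, q.Prime → q ∣ m → q ≠ 2 → jacobiSym (-((a / m : ℕ) : ℤ)) q = 1) :
    ‖((cohenH k a : ℚ) : ℚ_[ℓ])‖ ≤ 1 := by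
  obtain ⟨n₀, f, hsq, h4, hf, rfl, hdiv⟩ := exists_eq_mul_sq_of_cut hma ha4
  rw [hdiv] at hJ
  exact norm_ratCast_cohenH_cut_le_one_of_odd_prime hℓ2 hm1 hχ hχq hk hpar hsq h4 hf hJ

end CutCohen

/-! ## §5 The rational reading: the denominator of a cut Cohen number is a power of `2` -/

section Rational

omit hp

/-- If `‖q‖_ℓ ≤ 1` then `ℓ ∤ den q`. [folklore] -/
private theorem not_dvd_den_of_norm_le_one {ℓ : ℕ} [hℓ : Fact ℓ.Prime] {q : ℚ} (h : ‖(q : ℚ_[ℓ])‖ ≤ 1) : ¬ ℓ ∣ q.den := by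
  intro hdvd
  have hq0 : q ≠ 0 := by
    rintro rfl
    rw [Rat.den_zero] at hdvd
    exact hℓ.out.one_lt.ne' (Nat.dvd_one.mp hdvd)
  have hv : padicValRat ℓ q < 0 := by
    rw [padicValRat_def, sub_neg]
    have hnum : padicValInt ℓ q.num = 0 := by
      refine padicValInt.eq_zero_of_not_dvd fun h => ?_
      have hcop := q.reduced
      have : ℓ ∣ Nat.gcd q.num.natAbs q.den := Nat.dvd_gcd (Int.natCast_dvd.mp (by simpa using h)) hdvd
      rw [hcop] at this
      exact hℓ.out.one_lt.ne' (Nat.dvd_one.mp this)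
    rw [hnum]
    exact_mod_cast one_le_padicValNat_of_dvd q.den_nz hdvd
  have hnorm : ‖(q : ℚ_[ℓ])‖ = (ℓ : ℝ) ^ (-padicValRat ℓ q) := by
    rw [Padic.norm_eq_zpow_neg_valuation (by exact_mod_cast hq0), Padic.valuation_ratCast]
  have hgt : (1 : ℝ) < (ℓ : ℝ) ^ (-padicValRat ℓ q) :=
    one_lt_zpow₀ (by exact_mod_cast hℓ.out.one_lt) (by omega)
  rw [hnorm] at h
  exact absurd (hgt.trans_le h) (lt_irrefl _)

/-- **A rational number which is `ℓ`-integral at every odd prime `ℓ` has a power of `2` as denominator.** [folklore] -/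
theorem eq_two_of_dvd_den_of_forall_norm_le_one {q : ℚ}
    (h : ∀ ℓ : ℕ, [Fact ℓ.Prime] → ℓ ≠ 2 → ‖(q : ℚ_[ℓ])‖ ≤ 1) {ℓ : ℕ} (hℓ : ℓ.Prime) (hdvd : ℓ ∣ q.den) : ℓ = 2 := by
  by_contra hℓ2
  haveI : Fact ℓ.Prime := ⟨hℓ⟩
  exact not_dvd_den_of_norm_le_one (h ℓ hℓ2) hdvd

/-- Its packaging as `2^j · q ∈ ℤ` (`j = den q` works: `den q = 2^a` with `a < den q`). [folklore] -/
theorem exists_two_pow_mul_eq_intCast {q : ℚ} (h : ∀ ℓ : ℕ, ℓ.Prime → ℓ ∣ q.den → ℓ = 2) :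
    ∃ (j : ℕ) (z : ℤ), (2 : ℚ) ^ j * q = z := by
  have hden : q.den ∣ 2 ^ q.den := by
    rw [← Nat.factorization_le_iff_dvd q.den_nz (pow_ne_zero _ two_ne_zero), Nat.factorization_pow]
    intro ℓ
    by_cases hℓ : ℓ.Prime ∧ ℓ ∣ q.den
    · obtain rfl := h ℓ hℓ.1 hℓ.2
      rw [Finsupp.smul_apply, smul_eq_mul, Nat.Prime.factorization_self Nat.prime_two, mul_one]
      exact (Nat.factorization_lt 2 q.den_nz).le
    · have h0 : q.den.factorization ℓ = 0 := by
        rcases not_and_or.mp hℓ with h | h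
        · exact Nat.factorization_eq_zero_of_not_prime _ h
        · exact Nat.factorization_eq_zero_of_not_dvd h
      rw [h0]
      exact Nat.zero_le _
  obtain ⟨t, ht⟩ := hden
  refine ⟨q.den, t * q.num, ?_⟩
  have hq := Rat.num_div_den q
  have hd0 : (q.den : ℚ) ≠ 0 := by exact_mod_cast q.den_nz
  calc (2 : ℚ) ^ q.den * q = ((2 ^ q.den : ℕ) : ℚ) * q := by push_cast; ring
    _ = (q.den * t : ℕ) * (q.num / q.den : ℚ) := by rw [← ht, hq]
    _ = (t * q.num : ℤ) := by push_cast; field_simp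

end Rational

/-- **THE DENOMINATOR OF A CUT COHEN NUMBER IS A POWER OF `2`** (class character `χ` primitive quadratic modulo `m ≠ 1`,
`k ≥ 1` with the parity clause; cut index `a` with `m ∣ a`, `a/m ≡ 3 (mod 4)` and the Jacobi clauses): every prime dividing
`den H(k, a)` is `2` — all odd primes `ℓ` by Carlitz (§4; the crux prime `ℓ = p` included, cf. w4 g12's
`exists_padicInt_eq_cohenH_of_cut`). Hence (`exists_two_pow_mul_eq_intCast`) `2^j · H(k, a) ∈ ℤ`, and when `p ∣ H(k, a)` in `ℤ_p`
the coefficient `H(k, a)/p` lies in `ℤ[1/2] ⊆ ℤ̄[1/N]` for every even level `N` — the hypothesis currency of the typed q-expansion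
principle `Katz1973_qExpansionPrinciple_allCusps`. [cite: Carlitz1959, Theorem (integrality of k⁻¹B_{k,χ} for conductor with two distinct prime factors)]
[cite: Cohen1975, §2 (definition of H(r, N))] -/
theorem dvd_den_cohenH_cut_imp_eq_two {m : ℕ} [NeZero m] {χ : DirichletCharacter ℚ_[p] m} {k : ℕ}
    (hm1 : m ≠ 1) (hχ : χ.IsPrimitive) (hχq : χ.IsQuadratic) (hk : 1 ≤ k) (hpar : χ (-1) * (-1) ^ k = -1) {a : ℕ}
    (hma : m ∣ a) (ha4 : a / m % 4 = 3) (hJ : ∀ q : ℕ, q.Prime → q ∣ m → q ≠ 2 → jacobiSym (-((a / m : ℕ) : ℤ)) q = 1)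
    {ℓ : ℕ} (hℓ : ℓ.Prime) (hdvd : ℓ ∣ (cohenH k a).den) : ℓ = 2 :=
  eq_two_of_dvd_den_of_forall_norm_le_one
    (fun _ _ hℓ'2 => norm_ratCast_cohenH_le_one_of_cut_of_odd_prime hℓ'2 hm1 hχ hχq hk hpar hma ha4 hJ) hℓ hdvd

/-! ## §6 THE SOCKET FOR THE q-EXPANSION-PRINCIPLE STEP: a cut Cohen number divisible by `p` is `p · y` with `y ∈ ℤ[1/2] ⊆ ℤ̄[1/N]` -/

section Socket

/-- A rational `q` with `‖q‖_p < 1` and denominator a power of `2` is `p · y` with `2^j · y ∈ ℤ`. [folklore] -/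
theorem exists_eq_prime_mul_of_norm_lt_one {q : ℚ} (hq : ‖(q : ℚ_[p])‖ < 1)
    (hden : ∀ ℓ : ℕ, ℓ.Prime → ℓ ∣ q.den → ℓ = 2) :
    ∃ y : ℚ, q = p * y ∧ ∃ (j : ℕ) (z : ℤ), (2 : ℚ) ^ j * y = z := by
  obtain ⟨j, z, hz⟩ := exists_two_pow_mul_eq_intCast hden
  -- `p ∣ z = 2^j q` in `ℤ`
  have hz' : ‖((z : ℚ) : ℚ_[p])‖ < 1 := by
    rw [← hz, Rat.cast_mul, norm_mul]
    refine (mul_le_of_le_one_left (norm_nonneg _) ?_).trans_lt hq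
    have : ((2 : ℚ) ^ j : ℚ) = ((2 ^ j : ℤ) : ℚ) := by push_cast; ring
    rw [this, Rat.cast_intCast]
    exact Padic.norm_int_le_one _
  rw [Rat.cast_intCast] at hz'
  obtain ⟨w, hw⟩ := Padic.norm_intCast_lt_one_iff.mp hz'
  refine ⟨q / p, ?_, j, w, ?_⟩
  · rw [mul_div_cancel₀ _ (by exact_mod_cast hp.out.ne_zero)]
  · have hp0 : (p : ℚ) ≠ 0 := by exact_mod_cast hp.out.ne_zero
    rw [mul_div_assoc', hz, hw]
    push_cast
    rw [mul_div_cancel_left₀ _ hp0]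

/-- **THE (INT) SOCKET of the cusp glue.** For a class character `χ` primitive quadratic modulo `m ≠ 1` (`k ≥ 1`, parity
clause) and a cut index `a` (`m ∣ a`, `a/m ≡ 3 (mod 4)`, Jacobi clauses): if `p ∣ H(k, a)` in `ℤ_p` (`‖H(k,a)‖_p < 1` — what
`G = 0` says coefficientwise), then `H(k, a) = p · y` with `y ∈ ℤ[1/2]` (`2^j · y ∈ ℤ`). With `2 ∣ N` this is the hypothesis
currency `∃ y, (∃ j, IsIntegral ℤ (N^j · y)) ∧ coeff = p · y` of the typed q-expansion principle
`Katz1973_qExpansionPrinciple_allCusps` for the cut Cohen coefficients (and it survives the Cauchy product with the integral theta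
factor). [cite: Carlitz1959, Theorem (integrality of k⁻¹B_{k,χ} for conductor with two distinct prime factors)]
[cite: Katz1973, §1.6 Cor. 1.6.2] -/
theorem exists_eq_prime_mul_cohenH_of_cut_of_norm_lt_one {m : ℕ} [NeZero m] {χ : DirichletCharacter ℚ_[p] m} {k : ℕ}
    (hm1 : m ≠ 1) (hχ : χ.IsPrimitive) (hχq : χ.IsQuadratic) (hk : 1 ≤ k) (hpar : χ (-1) * (-1) ^ k = -1)
    {a : ℕ} (hma : m ∣ a) (ha4 : a / m % 4 = 3)
    (hJ : ∀ q : ℕ, q.Prime → q ∣ m → q ≠ 2 → jacobiSym (-((a / m : ℕ) : ℤ)) q = 1)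
    (hpa : ‖((cohenH k a : ℚ) : ℚ_[p])‖ < 1) :
    ∃ y : ℚ, cohenH k a = p * y ∧ ∃ (j : ℕ) (z : ℤ), (2 : ℚ) ^ j * y = z :=
  exists_eq_prime_mul_of_norm_lt_one hpa
    (fun _ hℓ hdvd => dvd_den_cohenH_cut_imp_eq_two hm1 hχ hχq hk hpar hma ha4 hJ hℓ hdvd)

omit hp in
/-- `y ∈ ℤ[1/2]` read in `ℂ` against an EVEN `N`: `N^j · y` is an integer, hence integral over `ℤ`. [folklore] -/
theorem exists_isIntegral_pow_mul_of_two_pow_mul {y : ℚ} {j : ℕ} {z : ℤ} (h : (2 : ℚ) ^ j * y = z) {N : ℕ} (hN : 2 ∣ N) :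
    ∃ j : ℕ, IsIntegral ℤ ((N : ℂ) ^ j * (y : ℂ)) := by
  obtain ⟨N', rfl⟩ := hN
  refine ⟨j, ?_⟩
  have e : (((2 * N' : ℕ) : ℂ)) ^ j * (y : ℂ) = (((N' : ℤ) ^ j * z : ℤ) : ℂ) := by
    have h' : ((((2 : ℚ) ^ j * y : ℚ)) : ℂ) = ((z : ℚ) : ℂ) := by rw [h]
    push_cast at h' ⊢
    rw [← h']
    ring
  rw [e, ← eq_intCast (algebraMap ℤ ℂ)]
  exact isIntegral_algebraMap

end Socket

end Summit.BirchSwinnertonDyer.BirchSwinnertonDyer.Theorems.PrintCFram.CohenCut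

end
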